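import Mathlib.Algebra.Field.ZMod
import Literature.InformationTheory.NetworkCoding.OneShot
import Summits.PneNP.PneNP.Theorems.CodingVolumeShiftsCodingVolumeLinAlg

/-!
# Route CodingVolumeShifts — crux `CodingVolume` (stmt-PneNP-19454): labels of a LINEAR one-shot
# code

A binary one-shot code `c : N.Code` on a k-pairs network is `𝔽₂`-LINEAR when every arc bit is an
`𝔽₂`-linear function of the input vector (`c.val a (x ⊕ y) = c.val a x ⊕ c.val a y`; XOR networks and
all linear network codes over `GF(2)` are of this kind). Such a code is the same thing as a LABELLING
of the arcs by functionals `φ a ∈ (𝔽₂^ι)^*` subject to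

* LOCALITY `(Loc)`: `φ b` lies in the span of the labels entering the tail of `b` together with the
  coordinate functional `x ↦ x_i` if the tail is `source i`;
* DECODABILITY `(Dec)`: the coordinate functional of commodity `i` lies in the span of the labels
  entering `sink i`.

This file extracts the labelling (`codingVolume_exists_linearLabels`, via
`mem_span_of_iInf_ker_le_ker`) and proves, for an abstract labelling over any field `K` satisfying
`(Loc)`/`(Dec)`, the structural facts the linear volume bounds use: labels out of sources are
multiples of their coordinate (`codingVolume_label_source`); SUPPORT — a label leaving a middle vertex
of rank `≤ r` only involves coordinates of commodities whose source has an EFFECTIVE (non-zero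
labelled) arc into a middle vertex of rank `≤ r` (`codingVolume_label_support`); every source has an
effective arc into a middle vertex (`codingVolume_exists_effective_arc`, needs `Far 2`); a sink with a
single in-arc is fed by a middle vertex that knows its coordinate (`codingVolume_pure_sink`). No
definitions: `(Loc)`, `(Dec)` and "middle vertex" (`∀ j, v ≠ source j ∧ v ≠ sink j`) are spelled out.
-/

set_option linter.dupNamespace false -- `Summit.PneNP.PneNP.…`: summit = sub-problem name (D-0017)

namespace Summit.PneNP.PneNP.Theorems

open Literature.InformationTheory.NetworkCoding Module Submodule Finset

section Bridge

variable {ι : Type} [Fintype ι] [DecidableEq ι] {N : KPairsNet ι}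

omit [DecidableEq ι] in
/-- **Labels of an `𝔽₂`-linear one-shot code.** If every arc bit of `c` is additive in the input
(`c.val a (x ⊕ y) = c.val a x ⊕ c.val a y`), there are functionals `φ a` on `𝔽₂^ι` computing the arc
bits (`φ a x̂ = c.val a x` on `0/1`-vectors) that satisfy LOCALITY (each label is in the span of the
labels entering its tail plus the tail's own source coordinate) and DECODABILITY (the coordinate of
commodity `i` is in the span of the labels entering `sink i`). (Locality/decodability of the code say
that the corresponding kernels are nested; `mem_span_of_iInf_ker_le_ker`.) [folklore] -/
theorem codingVolume_exists_linearLabels (c : N.Code)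
    (hlin : ∀ a (x y : ι → Bool), c.val a (fun i => xor (x i) (y i)) = xor (c.val a x) (c.val a y)) :
    ∃ φ : N.A → Module.Dual (ZMod 2) (ι → ZMod 2),
      (∀ a (x : ι → Bool),
        φ a (fun i => if x i then 1 else 0) = if c.val a x then 1 else 0) ∧
      (∀ b, φ b ∈ span (ZMod 2) (φ '' ↑(N.inArcs (N.src b)) ∪
        (fun i => (LinearMap.proj i : Module.Dual (ZMod 2) (ι → ZMod 2))) ''
          {i | N.source i = N.src b})) ∧
      (∀ i, (LinearMap.proj i : Module.Dual (ZMod 2) (ι → ZMod 2)) ∈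
        span (ZMod 2) (φ '' ↑(N.inArcs (N.sink i)))) := by
  classical
  -- `0/1`-vectors and back
  let toB : (ι → ZMod 2) → (ι → Bool) := fun z i => z i ≠ 0
  let toZ : Bool → ZMod 2 := fun b => if b then 1 else 0
  have hval0 : ∀ a, c.val a (fun _ => false) = false := by
    intro a
    have h := hlin a (fun _ => false) (fun _ => false)
    simpa using h
  have key2 : ∀ p q : ZMod 2, (decide (p + q ≠ 0)) = xor (decide (p ≠ 0)) (decide (q ≠ 0)) := by
    decide
  have htoB_add : ∀ z w : ι → ZMod 2, toB (z + w) = fun i => xor (toB z i) (toB w i) := by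
    intro z w
    funext i
    exact key2 (z i) (w i)
  have htoZ_xor : ∀ p q : Bool, toZ (xor p q) = toZ p + toZ q := by decide
  have htoB0 : toB 0 = fun _ => false := by funext i; simp [toB]
  -- the labels as linear maps
  have hsmul : ∀ (r : ZMod 2) (z : ι → ZMod 2) (a : N.A),
      toZ (c.val a (toB (r • z))) = r * toZ (c.val a (toB z)) := by
    intro r z a
    rcases (by decide : ∀ r : ZMod 2, r = 0 ∨ r = 1) r with rfl | rfl
    · rw [zero_smul, zero_mul, htoB0, hval0]
      rfl
    · rw [one_smul, one_mul]
  obtain ⟨φ, hφ⟩ : ∃ φ : N.A → Module.Dual (ZMod 2) (ι → ZMod 2),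
      ∀ a z, φ a z = toZ (c.val a (toB z)) :=
    ⟨fun a =>
      { toFun := fun z => toZ (c.val a (toB z))
        map_add' := fun z w => by
          show toZ (c.val a (toB (z + w))) = toZ (c.val a (toB z)) + toZ (c.val a (toB w))
          rw [htoB_add, hlin, htoZ_xor]
        map_smul' := fun r z => by
          show toZ (c.val a (toB (r • z))) = r * toZ (c.val a (toB z))
          exact hsmul r z a }, fun a z => rfl⟩
  have htoB_bool : ∀ x : ι → Bool, toB (fun i => if x i then 1 else 0) = x := by
    intro x; funext i
    rcases Bool.eq_false_or_eq_true (x i) with h | h <;> simp [toB, h]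
  -- kernel criterion: `φ a z = 0 ↔ c.val a (toB z) = false`
  have hker : ∀ a z, φ a z = 0 ↔ c.val a (toB z) = false := by
    intro a z
    rw [hφ]
    cases c.val a (toB z) <;> simp [toZ]
  refine ⟨φ, fun a x => by rw [hφ, htoB_bool], fun b => ?_, fun i => ?_⟩
  · -- locality
    let L : {a // a ∈ N.inArcs (N.src b)} ⊕ {i // N.source i = N.src b} →
        Module.Dual (ZMod 2) (ι → ZMod 2) :=
      Sum.elim (fun a => φ a.1) (fun i => LinearMap.proj i.1)
    have key : φ b ∈ span (ZMod 2) (Set.range L) := by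
      refine FiniteDimensional.mem_span_of_iInf_ker_le_ker fun z hz => ?_
      rw [Submodule.mem_iInf] at hz
      rw [LinearMap.mem_ker, hker]
      rw [← hval0 b]
      refine c.local_ b (toB z) (fun _ => false) (fun a ha => ?_) (fun i hi => ?_)
      · have hza := hz (Sum.inl ⟨a, by simp [KPairsNet.inArcs, ha]⟩)
        rw [LinearMap.mem_ker] at hza
        have hza' : φ a z = 0 := hza
        rw [hker] at hza'
        rw [hza', hval0]
      · have hzi := hz (Sum.inr ⟨i, hi⟩)
        rw [LinearMap.mem_ker] at hzi
        have hzi' : z i = 0 := hzi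
        simp [toB, hzi']
    refine span_mono (fun ψ hψ => ?_) key
    obtain ⟨j, rfl⟩ := hψ
    rcases j with ⟨a, ha⟩ | ⟨i, hi⟩
    · exact Set.mem_union_left _ ⟨a, Finset.mem_coe.mpr ha, rfl⟩
    · exact Set.mem_union_right _ ⟨i, hi, rfl⟩
  · -- decodability
    let L : {a // a ∈ N.inArcs (N.sink i)} → Module.Dual (ZMod 2) (ι → ZMod 2) := fun a => φ a.1
    have key : (LinearMap.proj i : Module.Dual (ZMod 2) (ι → ZMod 2)) ∈
        span (ZMod 2) (Set.range L) := by
      refine FiniteDimensional.mem_span_of_iInf_ker_le_ker fun z hz => ?_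
      rw [Submodule.mem_iInf] at hz
      rw [LinearMap.mem_ker]
      simp only [LinearMap.coe_proj, Function.eval]
      have hdec := c.decode i (toB z) (fun _ => false) (fun a ha => ?_)
      · simp only [toB, ne_eq, decide_eq_false_iff_not, Decidable.not_not] at hdec
        exact hdec
      · have hza := hz ⟨a, by simp [KPairsNet.inArcs, ha]⟩
        rw [LinearMap.mem_ker] at hza
        have hza' : φ a z = 0 := hza
        rw [hker] at hza'
        rw [hza', hval0]
    refine span_mono (fun ψ hψ => ?_) key
    obtain ⟨⟨a, ha⟩, rfl⟩ := hψ
    exact ⟨a, Finset.mem_coe.mpr ha, rfl⟩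

end Bridge

section Abstract

variable {K : Type*} [Field K] {ι : Type} [Fintype ι] [DecidableEq ι] {N : KPairsNet ι}
  {φ : N.A → Module.Dual K (ι → K)}

omit [Fintype ι] [DecidableEq ι] in
/-- Under LOCALITY, an arc leaving `source j` carries a multiple of the coordinate functional of
`j` (a source has no in-arcs). [folklore] -/
theorem codingVolume_label_source
    (hloc : ∀ b, φ b ∈ span K (φ '' ↑(N.inArcs (N.src b)) ∪
      (fun i => (LinearMap.proj i : Module.Dual K (ι → K))) '' {i | N.source i = N.src b}))
    (b : N.A) {j : ι} (hb : N.src b = N.source j) :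
    φ b ∈ span K {(LinearMap.proj j : Module.Dual K (ι → K))} := by
  have h := hloc b
  have hin : N.inArcs (N.src b) = ∅ := by
    rw [Finset.eq_empty_iff_forall_notMem]
    intro a ha
    simp only [KPairsNet.inArcs, Finset.mem_filter, Finset.mem_univ, true_and] at ha
    exact N.source_in a j (ha.trans hb)
  have hsrc : {i | N.source i = N.src b} = {j} := by
    ext i
    simp only [Set.mem_setOf_eq, Set.mem_singleton_iff]
    constructor
    · intro hi; exact N.source.injective (hi.trans hb)
    · rintro rfl; exact hb.symm
  rw [hin, hsrc] at h
  simpa using h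

omit [DecidableEq ι] in
/-- **SUPPORT LEMMA.** Under LOCALITY, a label leaving a middle vertex (neither a source nor a
sink) of rank `≤ r` lies in the span of the coordinate functionals of those commodities `j` whose
source has an EFFECTIVE arc — one with non-zero label — into a middle vertex of rank `≤ r`: by rank
induction, information enters the middle of the network only through such arcs. [folklore] -/
theorem codingVolume_label_support
    (hloc : ∀ b, φ b ∈ span K (φ '' ↑(N.inArcs (N.src b)) ∪
      (fun i => (LinearMap.proj i : Module.Dual K (ι → K))) '' {i | N.source i = N.src b}))
    (r : ℕ) (b : N.A) (hbM : ∀ j, N.src b ≠ N.source j) (hbr : N.rank (N.src b) ≤ r) :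
    φ b ∈ span K ((fun i => (LinearMap.proj i : Module.Dual K (ι → K))) ''
      {j | ∃ a, N.src a = N.source j ∧ (∀ l, N.tgt a ≠ N.sink l) ∧ N.rank (N.tgt a) ≤ r ∧
        φ a ≠ 0}) := by
  set S : Set ι := {j | ∃ a, N.src a = N.source j ∧ (∀ l, N.tgt a ≠ N.sink l) ∧
    N.rank (N.tgt a) ≤ r ∧ φ a ≠ 0} with hS
  suffices h : ∀ (q : ℕ) (b : N.A), N.rank (N.src b) = q → (∀ j, N.src b ≠ N.source j) →
      N.rank (N.src b) ≤ r →
      φ b ∈ span K ((fun i => (LinearMap.proj i : Module.Dual K (ι → K))) '' S) from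
    h _ b rfl hbM hbr
  intro q
  induction q using Nat.strong_induction_on with
  | _ q ih =>
    intro b hq hbM hbr
    have h := hloc b
    have hsrc : {i | N.source i = N.src b} = ∅ := by
      ext i
      simp only [Set.mem_setOf_eq, Set.mem_empty_iff_false, iff_false]
      exact fun hi => hbM i hi.symm
    rw [hsrc, Set.image_empty, Set.union_empty] at h
    refine (span_le.mpr ?_) h
    rintro ψ ⟨a, ha, rfl⟩
    simp only [Finset.mem_coe, KPairsNet.inArcs, Finset.mem_filter, Finset.mem_univ,
      true_and] at ha
    -- `a` enters the tail of `b`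
    by_cases hsa : ∃ j, N.src a = N.source j
    · obtain ⟨j, hj⟩ := hsa
      by_cases hz : φ a = 0
      · rw [hz]; exact zero_mem _
      · have hjS : j ∈ S := ⟨a, hj, fun l hl => hbM l ?_, by rw [ha]; exact hbr, hz⟩
        · exact span_mono (Set.singleton_subset_iff.mpr (Set.mem_image_of_mem _ hjS))
            (codingVolume_label_source hloc a hj)
        · exact absurd (ha.symm.trans hl) (N.sink_out b l)
    · push Not at hsa
      have hlt : N.rank (N.src a) < q := by rw [← hq, ← ha]; exact N.rank_lt a
      exact ih _ hlt a rfl hsa (by have := N.rank_lt a; rw [ha] at this; omega)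

/-- Every source has an EFFECTIVE arc into a middle vertex: an arc with non-zero label whose head is
not a sink (under LOCALITY and DECODABILITY, for a `2`-far pair: otherwise no label anywhere in the
middle of the network involves the coordinate of that commodity, and its sink — not adjacent to its
source — could not decode). [folklore] -/
theorem codingVolume_exists_effective_arc
    (hloc : ∀ b, φ b ∈ span K (φ '' ↑(N.inArcs (N.src b)) ∪
      (fun i => (LinearMap.proj i : Module.Dual K (ι → K))) '' {i | N.source i = N.src b}))
    (hdec : ∀ i, (LinearMap.proj i : Module.Dual K (ι → K)) ∈
      span K (φ '' ↑(N.inArcs (N.sink i))))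
    (i : ι) (hfar : (2 : ℕ∞) ≤ N.graph.edist (N.source i) (N.sink i)) :
    ∃ a, N.src a = N.source i ∧ (∀ l, N.tgt a ≠ N.sink l) ∧ φ a ≠ 0 := by
  by_contra hno
  push Not at hno
  -- every label with a middle tail avoids coordinate `i`
  set W : Submodule K (Module.Dual K (ι → K)) :=
    span K ((fun j => (LinearMap.proj j : Module.Dual K (ι → K))) '' {j | j ≠ i}) with hW
  have hmid : ∀ (q : ℕ) (b : N.A), N.rank (N.src b) = q → (∀ j, N.src b ≠ N.source j) →
      φ b ∈ W := by
    intro q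
    induction q using Nat.strong_induction_on with
    | _ q ih =>
      intro b hq hbM
      have h := hloc b
      have hsrc : {j | N.source j = N.src b} = ∅ := by
        ext j
        simp only [Set.mem_setOf_eq, Set.mem_empty_iff_false, iff_false]
        exact fun hj => hbM j hj.symm
      rw [hsrc, Set.image_empty, Set.union_empty] at h
      refine (span_le.mpr ?_) h
      rintro ψ ⟨a, ha, rfl⟩
      simp only [Finset.mem_coe, KPairsNet.inArcs, Finset.mem_filter, Finset.mem_univ,
        true_and] at ha
      by_cases hsa : ∃ j, N.src a = N.source j
      · obtain ⟨j, hj⟩ := hsa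
        by_cases hji : j = i
        · subst hji
          -- an arc from `source j` into the middle vertex `src b`: zero label by assumption
          have hz := hno a hj (fun l hl => N.sink_out b l (ha.symm.trans hl))
          change φ a ∈ W
          rw [hz]; exact zero_mem _
        · exact span_mono (Set.singleton_subset_iff.mpr
            (Set.mem_image_of_mem _ (show j ∈ {j | j ≠ i} from hji)))
            (codingVolume_label_source hloc a hj)
      · push Not at hsa
        have hlt : N.rank (N.src a) < q := by rw [← hq, ← ha]; exact N.rank_lt a
        exact ih _ hlt a rfl hsa
  -- hence so does every label entering `sink i`
  have hsink : span K (φ '' ↑(N.inArcs (N.sink i))) ≤ W := by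
    refine span_le.mpr ?_
    rintro ψ ⟨a, ha, rfl⟩
    simp only [Finset.mem_coe, KPairsNet.inArcs, Finset.mem_filter, Finset.mem_univ,
      true_and] at ha
    by_cases hsa : ∃ j, N.src a = N.source j
    · obtain ⟨j, hj⟩ := hsa
      by_cases hji : j = i
      · subst hji
        -- the arc `a : source j → sink j` makes the pair adjacent
        exfalso
        have hne : N.source j ≠ N.sink j := by
          intro h; rw [h, SimpleGraph.edist_self] at hfar; exact absurd hfar (by decide)
        have hadj : N.graph.Adj (N.source j) (N.sink j) := by
          rw [KPairsNet.graph, SimpleGraph.fromRel_adj]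
          exact ⟨hne, Or.inl ⟨a, hj, ha⟩⟩
        rw [SimpleGraph.edist_eq_one_iff_adj.mpr hadj] at hfar
        exact absurd hfar (by decide)
      · exact span_mono (Set.singleton_subset_iff.mpr
          (Set.mem_image_of_mem _ (show j ∈ {j | j ≠ i} from hji)))
          (codingVolume_label_source hloc a hj)
    · push Not at hsa
      exact hmid _ a rfl hsa
  have hi : (LinearMap.proj i : Module.Dual K (ι → K)) ∈ W := hsink (hdec i)
  rw [hW, codingVolume_mem_span_proj_iff] at hi
  have := hi i (by simp)
  simp at this

omit [Fintype ι] in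
/-- **Pure sinks are fed by a middle vertex that knows them.** If `sink i` has at most one in-arc
(under DECODABILITY it has exactly one, `b`), then the tail of `b` is a middle vertex — not a sink,
and (for a `2`-far pair) not a source — and the coordinate functional of `i` lies in the span of the
labels entering that tail (LOCALITY). [folklore] -/
theorem codingVolume_pure_sink
    (hloc : ∀ b, φ b ∈ span K (φ '' ↑(N.inArcs (N.src b)) ∪
      (fun i => (LinearMap.proj i : Module.Dual K (ι → K))) '' {i | N.source i = N.src b}))
    (hdec : ∀ i, (LinearMap.proj i : Module.Dual K (ι → K)) ∈
      span K (φ '' ↑(N.inArcs (N.sink i))))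
    (i : ι) (hfar : (2 : ℕ∞) ≤ N.graph.edist (N.source i) (N.sink i))
    (hcard : (N.inArcs (N.sink i)).card ≤ 1) :
    ∃ b, N.inArcs (N.sink i) = {b} ∧ (∀ l, N.src b ≠ N.source l) ∧ (∀ l, N.src b ≠ N.sink l) ∧
      (LinearMap.proj i : Module.Dual K (ι → K)) ∈ span K (φ '' ↑(N.inArcs (N.src b))) := by
  have hd := hdec i
  have hne : (N.inArcs (N.sink i)).Nonempty := by
    by_contra h
    rw [Finset.not_nonempty_iff_eq_empty] at h
    rw [h, Finset.coe_empty, Set.image_empty, span_empty, mem_bot] at hd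
    have := congrArg (fun ψ : Module.Dual K (ι → K) => ψ (Pi.single i 1)) hd
    simp at this
  obtain ⟨b, hb⟩ : ∃ b, N.inArcs (N.sink i) = {b} :=
    Finset.card_eq_one.mp (le_antisymm hcard hne.card_pos)
  have hbt : N.tgt b = N.sink i := by
    have : b ∈ N.inArcs (N.sink i) := by rw [hb]; exact Finset.mem_singleton_self b
    simpa [KPairsNet.inArcs] using this
  rw [hb, Finset.coe_singleton, Set.image_singleton] at hd
  -- the tail of `b` is not a source
  have hns : ∀ l, N.src b ≠ N.source l := by
    intro l hl
    have hφb := codingVolume_label_source hloc b hl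
    have hil : (LinearMap.proj i : Module.Dual K (ι → K)) ∈ span K {LinearMap.proj l} :=
      (span_le.mpr (Set.singleton_subset_iff.mpr hφb) :
        span K {φ b} ≤ span K {(LinearMap.proj l : Module.Dual K (ι → K))}) hd
    by_cases hli : l = i
    · subst hli
      have hne : N.source l ≠ N.sink l := by
        intro h; rw [h, SimpleGraph.edist_self] at hfar; exact absurd hfar (by decide)
      have hadj : N.graph.Adj (N.source l) (N.sink l) := by
        rw [KPairsNet.graph, SimpleGraph.fromRel_adj]
        exact ⟨hne, Or.inl ⟨b, hl, hbt⟩⟩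
      rw [SimpleGraph.edist_eq_one_iff_adj.mpr hadj] at hfar
      exact absurd hfar (by decide)
    · rw [mem_span_singleton] at hil
      obtain ⟨c0, hc0⟩ := hil
      have := congrArg (fun ψ : Module.Dual K (ι → K) => ψ (Pi.single i 1)) hc0
      simp [Pi.single_eq_of_ne hli] at this
  refine ⟨b, hb, hns, fun l => N.sink_out b l, ?_⟩
  -- locality at the middle vertex `src b`
  have h := hloc b
  have hsrc : {j | N.source j = N.src b} = ∅ := by
    ext j
    simp only [Set.mem_setOf_eq, Set.mem_empty_iff_false, iff_false]
    exact fun hj => hns j hj.symm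
  rw [hsrc, Set.image_empty, Set.union_empty] at h
  exact (span_le.mpr (Set.singleton_subset_iff.mpr h)) hd

end Abstract

end Summit.PneNP.PneNP.Theorems
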